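import Summits.BirchSwinnertonDyer.BirchSwinnertonDyer.Theorems.ManinLocalTwoThreeEulerRemaindersNinetySix
import HarnessLib

/-!
# Level 128, the `q`-toolkit: `E₂, E₄, E₆, E₈, E₁₂, E₁₆, E₂₄, E₃₂` and `E₂(δτ)` to `o(q³³)`

Cell bsd-f2-manin, route `ManinLocalTwoThree` (crux C2 `ManinOddAtFour` stmt-22967: `2² ∣ 128`; `128 = 2⁷`, `v₂(N) = 7` — the deepest `2`-adic cell of the charter's "no semistable partner" range; genus `9`, four newforms `128a–d`), prover seat p3 gen 24.
Class `128a` (`128a1 = [0, 1, 0, 1, 1] : y² = x³ + x² + x + 1`, full rational `2`-torsion): `𝓧 = x` is the single `η`-quotient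
`etaQuotient 128 (expFn [(2, -2), (4, 3), (8, -1), (16, -1), (32, 3), (64, -2)])` (`Γ₀(128)`-invariant), `𝓨 = η(expFn [(2, -2), (4, 1), (8, 1), (16, 1), (32, 1), (64, -2)])` satisfies `x′ = −2πiφ·2𝓨`, `𝓨² = x³ + x² + x + 1`, and
`φ₁₂₈a = -4B1 − 2B2 − 4B3 + 2B4 + B5 − 2B6` on an-g51's `η`-basis `B₁…B₅` of the new part (cell HOME/an/g51 `newform-coords-D.out`; the PINNING `⇑D.f = φ₁₂₈a` is
NOT proved here).  THE E₂ ROAD (`EtaLogDerivativeForms`): `𝓧′ = (πi/12)G_𝓧𝓧`, `𝓨′ = (πi/12)G_𝓨𝓨`; `A_j = B_jη(r_𝓨)/𝓧`,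
`C_j^{(2)} = B_j𝓧²/η(r_𝓨)`, `C_j^{(1)} = B_j𝓧/η(r_𝓨)`, `C_j^{(0)} = B_j/η(r_𝓨)` are INDIVIDUALLY HOLOMORPHIC weight-`2` `η`-quotients on `Γ₀(128)`
(Ligozat orders, `decide`), so (I2a), (I2b) are LINEAR relations in `M₂(Γ₀(128))` settled by Sturm (`μ = 192`, `⌊2·192/12⌋ + 1 = 33`
coefficients).
This file: the `q`-expansions to `o(q³³)` (pentagonal coefficients from the tree's `coeff_formalEulerPow_one_le_sixteen`; `E₂`, `E₄`, `E₂(2τ)`,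
`E₂(4τ)` to the same depth are p1's `LevelFortyFour.*_thirtyThree`, reused).
Pure `q`-series bookkeeping. Nothing here proves C2, Manin's conjecture or BSD; the other classes (`128b`, `128d` have no single η-quotient `y`) and the newform PINNING at `128` are separate; item 22967 stays OPEN. [cite: Zagier2008, §2.3] [cite: Ligozat1975, Ch. 3]
-/

set_option autoImplicit false
-- lint-debt: the directory name repeats the summit name (sibling precedent `ManinLocalTwoThreeEulerRemaindersSeventyTwo.lean`)
set_option linter.dupNamespace false

noncomputable section

open Complex Filter Topology Set Asymptotics Polynomial EisensteinSeries
open UpperHalfPlane hiding I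
open scoped Real Topology Manifold MatrixGroups ModularForm
open ModularForm CongruenceSubgroup
open Literature.NumberTheory.ModularForms
open Literature.NumberTheory.EllipticCurves Literature.NumberTheory.EllipticCurves.ModularForms

namespace Summit.BirchSwinnertonDyer.BirchSwinnertonDyer.Theorems.ManinLocalTwoThree.EulerRemaindersOneTwentyEight

open QRemainder EulerRemainders EtaLogDerivativeForms


/-- **`E₂(32τ)` to `o(q³³)`.** [cite: Zagier2008, §2.3] -/
theorem tendsto_E2_thirtyTwo :
    Tendsto (fun τ : ℍ ↦ (E2 (sixMulPt 32 τ) - (1 - 24 * X ^ 32 : ℂ[X]).eval (Function.Periodic.qParam 1 (τ : ℂ))) / Function.Periodic.qParam 1 (τ : ℂ) ^ 33) atImInfty (𝓝 0) := by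
  refine congr_poly ?_ (tendsto_E2_sixMulPt (by norm_num : 0 < 32) 33)
  obtain ⟨s1, s2, s3, s4, s5, s6, s7, s8, s9, s10, s11, s12, s13, s14, s15, s16, s17, s18, s19, s20, s21, s22, s23, s24, s25, s26, s27, s28, s29, s30, s31, s32, s33⟩ := LevelFortyFour.sigma_one_le_thirtyThree
  simp only [Finset.sum_range_succ, Finset.sum_range_zero, e2NatMulCoeff_eq _ _ (by norm_num : 0 < 32)]
  norm_num [s1, s2, s3, s4, s5, s6, s7, s8, s9, s10, s11, s12, s13, s14, s15, s16]
  simp only [map_ofNat]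
  ring

/-- **`E₂(64τ) = 1 + o(q³³)`.** [cite: Zagier2008, §2.3] -/
theorem tendsto_E2_sixtyFour :
    Tendsto (fun τ : ℍ ↦ (E2 (sixMulPt 64 τ) - (1 : ℂ[X]).eval (Function.Periodic.qParam 1 (τ : ℂ))) / Function.Periodic.qParam 1 (τ : ℂ) ^ 33) atImInfty (𝓝 0) := by
  refine congr_poly ?_ (tendsto_E2_sixMulPt (by norm_num : 0 < 64) 33)
  simp only [Finset.sum_range_succ, Finset.sum_range_zero, e2NatMulCoeff_eq _ _ (by norm_num : 0 < 64)]
  norm_num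

end Summit.BirchSwinnertonDyer.BirchSwinnertonDyer.Theorems.ManinLocalTwoThree.EulerRemaindersOneTwentyEight

end
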